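import Summits.Ventures.PercRepro0.LocalLaw
import Mathlib.Analysis.Calculus.Deriv.Mul
import Mathlib.Analysis.Calculus.Deriv.Add

/-!
# Russo's formula (seat p4, block P5 in Lean, 2/2)

SHARP-p4-v2 Lemma 1.3 on `Defs`: for an increasing event `A` determined by a finite set of bonds `E`,
`p ↦ P_p(A)` is differentiable on `(0,1)` with derivative `∑_{e ∈ E} P_p(Piv_e(A))`, where `Piv e A` is the event
«`e` is pivotal for `A`» (opening `e` puts the configuration in `A`, closing it takes it out); and
`P_p(Piv_e(A) ∩ {e closed}) = (1 − p) P_p(Piv_e(A))`.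

Method: `LocalLaw.lean` identifies `P_p(A)` with the polynomial `∑_{η ⊆ E} 1[η ∈ A] ∏_{e ∈ E} (if e ∈ η then p else 1 − p)`
(`locC`, the instance-free form of `locP`); each weight is a finite product whose derivative is the sum over the
coordinates `e` of the product with the factor at `e` removed, signed `+1` if `e ∈ η`, `−1` otherwise
(`HasDerivAt.finsetProd`); regrouping by `e` and splitting the subsets of `E` according to `e` (`Finset.sum_powerset_insert`,
the paper's conditioning on `ω_e`) gives `∑_e [locC (E ∖ e) (η ↦ η ∪ {e} ∈ A) − locC (E ∖ e) (η ↦ η ∈ A)]`, and for an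
increasing `A` the bracket is the weight of the configurations on `E ∖ e` for which `e` is pivotal.
-/

namespace Summit.Ventures.PercRepro0.Russo

open MeasureTheory ProbabilityTheory unitInterval Set
open Summit.Ventures.PercRepro0.Defs
open scoped ENNReal NNReal Classical

variable {ι : Type*}

/-! ### The instance-free polynomial -/

/-- `locC E 𝒜 q = ∑_{η ⊆ E} 1[𝒜 η] · wt E η q`, with classical decidability baked in (no instance arguments, so that
statements about concrete predicates never disagree on instances). -/
noncomputable def locC [DecidableEq ι] (E : Finset ι) (𝒜 : Finset ι → Prop) (q : ℝ) : ℝ :=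
  ∑ η ∈ E.powerset, if 𝒜 η then wt E η q else 0

/-- `locC` only depends on the predicate on the subsets of `E`. -/
theorem locC_congr [DecidableEq ι] (E : Finset ι) {𝒜 ℬ : Finset ι → Prop}
    (h : ∀ η ∈ E.powerset, (𝒜 η ↔ ℬ η)) (q : ℝ) : locC E 𝒜 q = locC E ℬ q := by
  unfold locC
  refine Finset.sum_congr rfl fun η hη => ?_
  simp only [h η hη]

/-- `locC` is nonnegative on `[0,1]`. -/
theorem locC_nonneg [DecidableEq ι] (E : Finset ι) (𝒜 : Finset ι → Prop) {q : ℝ} (h0 : 0 ≤ q) (h1 : q ≤ 1) :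
    0 ≤ locC E 𝒜 q :=
  Finset.sum_nonneg fun η _ => by split_ifs <;> [exact wt_nonneg E η h0 h1; exact le_rfl]

/-- The law of a finitely-determined event is `locC` (instance-free form of `setBernoulli_toReal_eq_locP`). -/
theorem setBernoulli_toReal_eq_locC [Countable ι] [DecidableEq ι] (u : Set ι) (p : I) (E : Finset ι)
    (hE : (↑E : Set ι) ⊆ u) {A : Set (Set ι)} (hdet : DeterminedBy (↑E) A) :
    (setBernoulli u p A).toReal = locC E (fun η : Finset ι => (↑η : Set ι) ∈ A) p := by
  rw [setBernoulli_toReal_eq_locP u p E hE hdet]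
  unfold locC locP
  refine Finset.sum_congr rfl fun η _ => ?_
  congr

/-! ### Russo's formula for the polynomial -/

/-- The derivative of one factor of `wt`. -/
theorem hasDerivAt_factor [DecidableEq ι] (e : ι) (η : Finset ι) (q : ℝ) :
    HasDerivAt (fun q : ℝ => if e ∈ η then q else 1 - q) (if e ∈ η then (1 : ℝ) else -1) q := by
  by_cases h : e ∈ η
  · simp only [h, if_true]; exact hasDerivAt_id' q
  · simp only [h, if_false]; exact HasDerivAt.const_sub 1 (hasDerivAt_id' q)

/-- The derivative of a weight: remove one factor, with sign `+1` for an open coordinate, `−1` for a closed one. -/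
theorem hasDerivAt_wt [DecidableEq ι] (E η : Finset ι) (q : ℝ) :
    HasDerivAt (wt E η) (∑ e ∈ E, wt (E.erase e) η q * (if e ∈ η then 1 else -1)) q := by
  have h := HasDerivAt.finsetProd (u := E) (f := fun e q => if e ∈ η then q else 1 - q)
    (f' := fun e => if e ∈ η then (1 : ℝ) else -1) (x := q) (fun e _ => hasDerivAt_factor e η q)
  have hfun : wt E η = ∏ i ∈ E, (fun q : ℝ => if i ∈ η then q else 1 - q) := by
    funext r
    simp [wt, Finset.prod_apply]
  rw [hfun]
  refine h.congr_deriv ?_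
  refine Finset.sum_congr rfl fun e _ => ?_
  rw [smul_eq_mul]
  rfl

/-- The derivative of `locC`, term by term. -/
theorem hasDerivAt_locC [DecidableEq ι] (E : Finset ι) (𝒜 : Finset ι → Prop) (q : ℝ) :
    HasDerivAt (locC E 𝒜)
      (∑ η ∈ E.powerset, if 𝒜 η then ∑ e ∈ E, wt (E.erase e) η q * (if e ∈ η then 1 else -1) else 0) q := by
  unfold locC
  refine HasDerivAt.fun_sum fun η _ => ?_
  by_cases h : 𝒜 η
  · simp only [h, if_true]; exact hasDerivAt_wt E η q
  · simp only [h, if_false]; exact hasDerivAt_const q 0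

/-- Splitting a sum over the subsets of `insert e T` according to the coordinate `e` (SHARP-p4-v2 Lemma 1.3:
conditioning on `ω_e`). -/
theorem sum_powerset_insert_split [DecidableEq ι] (T : Finset ι) {e : ι} (he : e ∉ T) (𝒜 : Finset ι → Prop) (q : ℝ) :
    (∑ η ∈ (insert e T).powerset, if 𝒜 η then wt T η q * (if e ∈ η then 1 else -1) else 0) =
      ∑ ζ ∈ T.powerset, ((if 𝒜 (insert e ζ) then 1 else 0) - (if 𝒜 ζ then 1 else 0)) * wt T ζ q := by
  rw [Finset.sum_powerset_insert he, ← Finset.sum_add_distrib]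
  refine Finset.sum_congr rfl fun ζ hζ => ?_
  have heζ : e ∉ ζ := fun h => he (Finset.mem_powerset.1 hζ h)
  have hwt : wt T (insert e ζ) q = wt T ζ q := by
    unfold wt
    refine Finset.prod_congr rfl fun j hj => ?_
    have : j ≠ e := fun h => he (h ▸ hj)
    simp [Finset.mem_insert, this]
  simp only [heζ, Finset.mem_insert_self, if_true, if_false, hwt]
  split_ifs <;> ring

/-- Russo's formula for the polynomial (difference form): the derivative of `locC E 𝒜` is the sum over the
coordinates `e` of `∑_{ζ ⊆ E ∖ e} (1[𝒜 (ζ ∪ {e})] − 1[𝒜 ζ]) wt (E ∖ e) ζ`. -/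
theorem hasDerivAt_locC' [DecidableEq ι] (E : Finset ι) (𝒜 : Finset ι → Prop) (q : ℝ) :
    HasDerivAt (locC E 𝒜) (∑ e ∈ E, ∑ ζ ∈ (E.erase e).powerset,
      ((if 𝒜 (insert e ζ) then 1 else 0) - (if 𝒜 ζ then 1 else 0)) * wt (E.erase e) ζ q) q := by
  refine (hasDerivAt_locC E 𝒜 q).congr_deriv ?_
  have h1 : ∀ η, (if 𝒜 η then ∑ e ∈ E, wt (E.erase e) η q * (if e ∈ η then 1 else -1) else 0) =
      ∑ e ∈ E, (if 𝒜 η then wt (E.erase e) η q * (if e ∈ η then 1 else -1) else 0) := fun η => by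
    split_ifs <;> simp
  rw [Finset.sum_congr rfl fun η _ => h1 η, Finset.sum_comm]
  refine Finset.sum_congr rfl fun e he => ?_
  rw [← sum_powerset_insert_split (E.erase e) (Finset.notMem_erase e E) 𝒜 q, Finset.insert_erase he]

/-- **Russo's formula for the polynomial** (SHARP-p4-v2 Lemma 1.3): for an increasing `𝒜`, the derivative of
`locC E 𝒜` is the sum over `e ∈ E` of the weight of the configurations on `E ∖ e` for which `e` is pivotal. -/
theorem hasDerivAt_locC_piv [DecidableEq ι] (E : Finset ι) (𝒜 : Finset ι → Prop)
    (hmono : ∀ η ζ, η ⊆ ζ → 𝒜 η → 𝒜 ζ) (q : ℝ) :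
    HasDerivAt (locC E 𝒜) (∑ e ∈ E, locC (E.erase e) (fun ζ => 𝒜 (insert e ζ) ∧ ¬ 𝒜 ζ) q) q := by
  refine (hasDerivAt_locC' E 𝒜 q).congr_deriv ?_
  refine Finset.sum_congr rfl fun e _ => ?_
  unfold locC
  refine Finset.sum_congr rfl fun ζ _ => ?_
  by_cases h1 : 𝒜 ζ
  · have h2 : 𝒜 (insert e ζ) := hmono _ _ (Finset.subset_insert e ζ) h1
    simp [h1, h2]
  · by_cases h2 : 𝒜 (insert e ζ) <;> simp [h1, h2]

/-- Weights on `insert e T` for a configuration not containing `e`: the factor at `e` is `1 − q`. -/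
theorem wt_insert_of_notMem [DecidableEq ι] (T : Finset ι) {e : ι} (he : e ∉ T) {ζ : Finset ι} (heζ : e ∉ ζ)
    (q : ℝ) : wt (insert e T) ζ q = (1 - q) * wt T ζ q := by
  unfold wt
  rw [Finset.prod_insert he, if_neg heζ]

/-- `locC E (𝒜 ∧ e ∉ ·) = (1 − q) · locC (E ∖ e) 𝒜` for `e ∈ E` (the coordinate `e` is closed with probability `1 − q`,
independently of the rest). -/
theorem locC_and_notMem [DecidableEq ι] (E : Finset ι) {e : ι} (he : e ∈ E) (𝒜 : Finset ι → Prop) (q : ℝ) :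
    locC E (fun η => 𝒜 η ∧ e ∉ η) q = (1 - q) * locC (E.erase e) 𝒜 q := by
  unfold locC
  rw [Finset.mul_sum]
  conv_lhs => rw [← Finset.insert_erase he]
  rw [Finset.sum_powerset_insert (Finset.notMem_erase e E)]
  simp only [Finset.mem_insert_self, not_true_eq_false, and_false, if_false, Finset.sum_const_zero, add_zero]
  refine Finset.sum_congr rfl fun ζ hζ => ?_
  have heζ : e ∉ ζ := fun h => Finset.notMem_erase e E (Finset.mem_powerset.1 hζ h)
  rw [wt_insert_of_notMem _ (Finset.notMem_erase e E) heζ]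
  simp only [heζ, not_false_eq_true, and_true]
  split_ifs <;> simp

/-! ### Russo's formula for `P_p` on `Defs` -/

variable {d : ℕ}

/-- The event «`e` is pivotal for `A`»: opening `e` puts the configuration in `A`, closing it takes it out. -/
def Piv (e : Sym2 (Vertex d)) (A : Set (Config d)) : Set (Config d) :=
  {ω | insert e ω ∈ A ∧ ω \ {e} ∉ A}

/-- Pivotality for an `E`-determined event is determined by `E ∖ {e}` (it does not depend on `ω_e`). -/
theorem determinedBy_piv {E : Set (Sym2 (Vertex d))} {A : Set (Config d)} (hdet : DeterminedBy E A)
    (e : Sym2 (Vertex d)) : DeterminedBy (E \ {e}) (Piv e A) := by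
  intro ω ω' h
  have h1 : ∀ f ∈ E, (f ∈ insert e ω ↔ f ∈ insert e ω') := by
    intro f hf
    by_cases hfe : f = e
    · simp [hfe]
    · simp only [Set.mem_insert_iff, hfe, false_or]
      exact h f ⟨hf, hfe⟩
  have h2 : ∀ f ∈ E, (f ∈ ω \ {e} ↔ f ∈ ω' \ {e}) := by
    intro f hf
    by_cases hfe : f = e
    · simp [hfe]
    · simp only [Set.mem_sdiff, Set.mem_singleton_iff, hfe, not_false_eq_true, and_true]
      exact h f ⟨hf, hfe⟩
  exact and_congr (hdet _ _ h1) (not_congr (hdet _ _ h2))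

/-- The law of a finitely-determined event as the polynomial `locC`. -/
theorem P_toReal_eq_locC (p : I) {E : Finset (Sym2 (Vertex d))} (hE : (↑E : Set (Sym2 (Vertex d))) ⊆ bonds d)
    {A : Set (Config d)} (hdet : DeterminedBy (↑E) A) :
    (P d p A).toReal = locC E (fun η : Finset (Sym2 (Vertex d)) => (↑η : Set (Sym2 (Vertex d))) ∈ A) p := by
  unfold P
  exact setBernoulli_toReal_eq_locC (bonds d) p E hE hdet

/-- The local form of pivotality: for `e ∉ ζ`, `ζ ∈ Piv e A ↔ ζ ∪ {e} ∈ A ∧ ζ ∉ A`. -/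
theorem coe_mem_piv_iff {A : Set (Config d)} {e : Sym2 (Vertex d)} {ζ : Finset (Sym2 (Vertex d))} (heζ : e ∉ ζ) :
    (↑ζ : Set (Sym2 (Vertex d))) ∈ Piv e A ↔
      (↑(insert e ζ) : Set (Sym2 (Vertex d))) ∈ A ∧ ¬ (↑ζ : Set (Sym2 (Vertex d))) ∈ A := by
  have heζ' : e ∉ (↑ζ : Set (Sym2 (Vertex d))) := by simpa using heζ
  simp only [Piv, Set.mem_setOf_eq, Finset.coe_insert, Set.sdiff_singleton_eq_self heζ']

/-- The law of the pivotal event as a polynomial on `E ∖ e`. -/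
theorem P_piv_toReal_eq_locC (p : I) {E : Finset (Sym2 (Vertex d))} (hE : (↑E : Set (Sym2 (Vertex d))) ⊆ bonds d)
    {A : Set (Config d)} (hdet : DeterminedBy (↑E) A) (e : Sym2 (Vertex d)) :
    (P d p (Piv e A)).toReal = locC (E.erase e)
      (fun ζ : Finset (Sym2 (Vertex d)) =>
        (↑(insert e ζ) : Set (Sym2 (Vertex d))) ∈ A ∧ ¬ (↑ζ : Set (Sym2 (Vertex d))) ∈ A) p := by
  have hdet' : DeterminedBy (↑(E.erase e)) (Piv e A) := by
    rw [Finset.coe_erase]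
    exact determinedBy_piv hdet e
  rw [P_toReal_eq_locC p ((Finset.coe_subset.2 (Finset.erase_subset e E)).trans hE) hdet']
  refine locC_congr _ (fun ζ hζ => ?_) p
  exact coe_mem_piv_iff fun h => Finset.notMem_erase e E (Finset.mem_powerset.1 hζ h)

/-- The coordinate `(clamp r : ℝ) = r` on `[0,1]`. -/
theorem coe_clamp_of_mem {r : ℝ} (h0 : 0 ≤ r) (h1 : r ≤ 1) : ((clamp r : I) : ℝ) = r := by
  unfold clamp
  rw [Set.projIcc_of_mem _ ⟨h0, h1⟩]

/-- **Russo's formula on `Defs`** (SHARP-p4-v2 Lemma 1.3): for an increasing event `A` determined by a finite set of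
bonds `E`, `p ↦ P_p(A)` is differentiable on `(0,1)` with derivative `∑_{e ∈ E} P_p(Piv_e(A))`. -/
theorem hasDerivAt_P (q : ℝ) (hq0 : 0 < q) (hq1 : q < 1) {E : Finset (Sym2 (Vertex d))}
    (hE : (↑E : Set (Sym2 (Vertex d))) ⊆ bonds d) {A : Set (Config d)} (hdet : DeterminedBy (↑E) A)
    (hinc : IsUpperSet A) :
    HasDerivAt (fun r : ℝ => (P d (clamp r) A).toReal) (∑ e ∈ E, (P d (clamp q) (Piv e A)).toReal) q := by
  set 𝒜 : Finset (Sym2 (Vertex d)) → Prop := fun η => (↑η : Set (Sym2 (Vertex d))) ∈ A with h𝒜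
  have hmono : ∀ η ζ, η ⊆ ζ → 𝒜 η → 𝒜 ζ := fun η ζ h hη => hinc (Finset.coe_subset.2 h) hη
  have hd := hasDerivAt_locC_piv E 𝒜 hmono q
  have hq : ((clamp q : I) : ℝ) = q := coe_clamp_of_mem hq0.le hq1.le
  have hderiv : (∑ e ∈ E, locC (E.erase e) (fun ζ => 𝒜 (insert e ζ) ∧ ¬ 𝒜 ζ) q) =
      ∑ e ∈ E, (P d (clamp q) (Piv e A)).toReal := by
    refine Finset.sum_congr rfl fun e _ => ?_
    rw [P_piv_toReal_eq_locC (clamp q) hE hdet e, hq]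
  rw [hderiv] at hd
  refine hd.congr_of_eventuallyEq ?_
  filter_upwards [Ioo_mem_nhds hq0 hq1] with r hr
  rw [P_toReal_eq_locC (clamp r) hE hdet, coe_clamp_of_mem hr.1.le hr.2.le]

/-- `P_p(Piv_e(A) ∩ {e closed}) = (1 − p) · P_p(Piv_e(A))` for `e ∈ E`. -/
theorem P_piv_inter_closed (p : I) {E : Finset (Sym2 (Vertex d))} (hE : (↑E : Set (Sym2 (Vertex d))) ⊆ bonds d)
    {A : Set (Config d)} (hdet : DeterminedBy (↑E) A) {e : Sym2 (Vertex d)} (he : e ∈ E) :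
    (P d p (Piv e A ∩ {ω | e ∉ ω})).toReal = (1 - p) * (P d p (Piv e A)).toReal := by
  have hdet' : DeterminedBy (↑E) (Piv e A ∩ {ω | e ∉ ω}) := by
    intro ω ω' h
    have hsub : ∀ f ∈ (↑E : Set (Sym2 (Vertex d))) \ {e}, (f ∈ ω ↔ f ∈ ω') := fun f hf => h f hf.1
    exact and_congr (determinedBy_piv hdet e ω ω' hsub) (not_congr (h e he))
  rw [P_toReal_eq_locC p hE hdet', P_piv_toReal_eq_locC p hE hdet e, ← locC_and_notMem E he]
  refine locC_congr _ (fun ζ hζ => ?_) p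
  constructor
  · rintro ⟨h1, h2⟩
    have h2' : e ∉ ζ := by simpa using h2
    exact ⟨(coe_mem_piv_iff h2').1 h1, h2'⟩
  · rintro ⟨h1, h2⟩
    exact ⟨(coe_mem_piv_iff h2).2 h1, by simpa using h2⟩

end Summit.Ventures.PercRepro0.Russo
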